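import Summits.HodgeConjecture.CorCM.MultiFieldWeilNonIsomorphicFamilies
import Summits.HodgeConjecture.CorCM.MultiFieldWeilNonIsomorphicSextics
import Summits.HodgeConjecture.CorCM.MultiFieldWeilCoprimeOneMember
import Summits.HodgeConjecture.CorCM.SimpleCMProductsDimLeThreeBlocks
import Mathlib.GroupTheory.GroupAction.Blocks
import HarnessLib

/-!
# MULTI-FIELD WEIL ENGINE — PRIME RELATIVE DEGREES: ONE VALUE OUTSIDE A GALOIS CLOSURE GIVES STABILISER-TRANSITIVITY;
# NON-ISOMORPHIC SEXTIC CM FIELDS THROUGH `k` LIE OUTSIDE EACH OTHER'S GALOIS CLOSURES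

Cell `pub-hodgecm2` (COR-CM), seat b30 gen 36 (2026-08-25); count-neutral own lane MULTI-FIELD WEIL ENGINE (stem `MultiFieldWeil*`), sequel of
`CorCM/MultiFieldWeilNonIsomorphicFamilies.lean` (V2: the no-tower headline under stabiliser-transitivity `hST`; sextic slots from values outside the
Galois closures) and `CorCM/MultiFieldWeilNonIsomorphicSextics.lean` (gen 31: two relative cubics without homomorphisms are linearly disjoint).
Theorems only; no definition, no named fact, no `sorry`.  HONEST FRAMING: §2's general headline is conditional on the displayed single-slot Weil spaces
`hW m`; the Markman consumers are conditional ONLY on `Markman2025_weilClasses_algebraic_abelianFourfold` (sextic slots) ∕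
`Markman2025_weilClasses_algebraic_hyperbolicSixfold` (decic slots); `HC_CM` is NOT proved and not asserted.

§1 **BLOCKS OF PRIME SIZE** (`stabTransitive_of_mover_prime`).  `R ⊆ ∏_m Sym(n_m)` closed under products and inverses, non-empty, TRANSITIVE on the slot
`m` of PRIME size `n_m`.  The tuples of `R` trivial at `m₀` form a NORMAL subgroup of `R`, so their orbits on the slot `m` are blocks of the transitive
group `R` (Mathlib `MulAction.IsBlock.orbit_of_normal`), hence of a size dividing `n_m` (`MulAction.IsBlock.ncard_dvd_card`): `1` or `n_m`.  ONE
position moved by ONE tuple trivial at `m₀` therefore makes the tuples trivial at `m₀` TRANSITIVE on the slot `m` — for every prime `n_m`, where V2's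
`stabTransitive_of_movers_three` needed every position moved and `n_m = 3`.

§1b–§1c **REALISED** (`stabTransitive_realisedTuples_of_outside_prime`, automorphism form `exists_aut_fix_comp_eq_of_outside_prime`): `k = Kf i₀`
imaginary quadratic, `τ : k → ℂ`, `K_m = Kf (is m) ⊇ i_m(k)` with `n_m = [K_m : k]` PRIME.  If ONE `τ`-embedding of `K_m` takes ONE value outside the
Galois closure `L(K_{m₀})` of `K_{m₀}` in `ℂ`, then for all `τ`-embeddings `s, s'` of `K_m` some automorphism of `ℂ` over `τ(k)` fixes every
`τ`-embedding of `K_{m₀}` and carries `s` to `s'` — the hypothesis `hST` of V2 for the pair `(m₀, m)` (the realised tuples are transitive on every slot,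
`transitive_realisedTuples`; the mover is V2's `exists_realisedTuple_trivial_apply_ne`).  For a prime relative degree the condition is also necessary
for `hST` unless `n_m = 1`, and it does not depend on the embedding chosen (`L(K_{m₀})` is normal).

§2 **HEADLINES.**  `hodgeConjectureFor_biproduct_comp_of_primes_of_outside_closures`: `E = A 0 ⊨ (k; {τ})`, `B_m = A (m+1) ⊨ (K_m; Φ (m+1))`,
`[K_m : ℚ] = 2 n_m` with `n_m` PRIME, `k`-signatures `p_m` (`0 < p_m`, `2 p_m ≤ n_m`); HYPOTHESIS: for all `m₀ ≠ m` SOME `τ`-embedding of `K_m` takes SOME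
value outside `L(K_{m₀})`.  Then the Hodge conjecture holds for EVERY product of copies `⨁_j A(κ j)` given the single-slot Weil spaces; for sextic
`(1,2)` and decic `(2,3)` slots GIVEN ONLY Markman's two theorems (`hodgeConjectureFor_biproduct_comp_of_sexticsDecics_of_outside_closures`) — V2 §4
(sextic only, every embedding outside) extended to all prime relative degrees; no tower, no ordering, no degree computation.

§3 **NON-ISOMORPHIC SEXTIC CM FIELDS THROUGH `k`** (`exists_apply_not_mem_normalClosure_of_isEmpty_ringHom`).  `K_m`, `K_{m₀}` SEXTIC CM fields
containing `k` with NO ring homomorphism `K_m → K_{m₀}`.  Then EVERY `τ`-embedding of `K_m` takes a value outside `L(K_{m₀})`: otherwise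
`ℚ(τk)·u(K_{m₀})·s(K_m) ⊆ L(K_{m₀})` for a `τ`-embedding `u` of `K_{m₀}`, a field of degree `18` (gen 31's `finrank_adjoin_pair_of_isEmpty_ringHom`: the
relative cubic of `K_m` has no root in `K_{m₀}`, so stays irreducible) inside the Galois closure of a sextic CM field with an imaginary quadratic
subfield, which has degree `6` or `12` (seat b16's `finrank_normalClosure_of_quadratic`, Dodson).  HEADLINE
**`hodgeConjectureFor_biproduct_comp_of_sextics_of_isEmpty_ringHom`**: `E ⊨ (k; {τ})` and ANY number of `(1,2)`-threefolds `T_m ⊨ (K_m; Φ_m)` over SEXTIC CM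
fields `K_m ⊇ i_m(k)`, PAIRWISE WITHOUT ring homomorphisms (`Hom(K_m, K_{m₀}) = ∅` for `m₀ ≠ m`, i.e. pairwise non-isomorphic): the Hodge conjecture for
EVERY product of copies `E^a × ∏_m T_m^{b_m}` GIVEN ONLY Markman's fourfold theorem.  This is gen 31's two-field theorem
(`hodgeConjectureFor_biproduct_comp_of_two_sextics_of_isEmpty`) for any number of fields, and V2 §4 with its closure hypothesis discharged.  (Example:
`k` any imaginary quadratic field, `K_m = k·F_m` for pairwise non-isomorphic totally real cubic fields `F_m`, e.g. the cubic subfields of `ℚ(ζ₇)`,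
`ℚ(ζ₉)`, `ℚ(ζ₁₃)`.  NOT covered, honestly: several non-isogenous threefolds over ISOMORPHIC sextic fields — seat b16's (ii′) —, beyond the pair `N5`.)

[cite: DixonMortimer1996, §1.6, Thm. 1.6A and Thm. 1.7] [cite: Lang2002, VI §1 Thm. 1.1, Cor. 1.6 and V §1 Prop. 1.2] [cite: Shimura1998, §18.2 Lemma (i)]
[cite: Dodson1984, §5.1.2 Theorem] [cite: Markman2025SurveySecant, Thm. 1.2] [cite: Markman2025SecantWeil, Thm 1.5.1] [cite: Pohlmann1968, Thm 1]
[cite: MoonenZarhin1995Duke, Thm. 2.4] [cite: MumfordAV1970, §19]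

## References
* [DixonMortimer1996] J. D. Dixon, B. Mortimer, *Permutation Groups*, GTM 163, §1.6 (blocks; orbits of a normal subgroup, Thm. 1.6A), Thm. 1.7.
* [Lang2002] S. Lang, *Algebra*, GTM 211, V §1 Prop. 1.2, VI §1 Thm. 1.1, Cor. 1.6.  [Shimura1998] G. Shimura, *Abelian varieties with complex multiplication
  and modular functions*, §18.2 Lemma (i).  [Dodson1984] B. Dodson, *The structure of Galois groups of CM-fields*, Trans. AMS 283 (1984), §5.1.2.
* [Markman2025SurveySecant] E. Markman, arXiv:2509.23403, Thm. 1.2.  [Markman2025SecantWeil] E. Markman, Cycles on abelian 2n-folds of Weil type from secant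
  sheaves on abelian n-folds, Thm 1.5.1.  [Pohlmann1968] H. Pohlmann, Ann. of Math. 88 (1968), Thm 1.  [MoonenZarhin1995Duke] B. Moonen, Yu. Zarhin, Duke
  Math. J. 77 (1995), Thm. 2.4.  [MumfordAV1970] D. Mumford, *Abelian Varieties*, §19.
-/

noncomputable section

open CategoryTheory CategoryTheory.Limits NumberField IntermediateField

namespace Summit.HodgeConjecture.CorCM.MultiFieldWeil

open Finset
open Literature.AlgebraicGeometry Literature.AlgebraicGeometry.Motives Literature.AlgebraicGeometry.HodgeTheory
open Literature.AlgebraicGeometry.ComplexMultiplication (IsCMTypeRealisation)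
open Literature.AlgebraicTopology.SingularHomology
open Literature.NumberTheory.ComplexMultiplication
open Summit.HodgeConjecture.CorCM.Census.MultiFieldWeil

open scoped Classical

/-! ## §1 Model: on a slot of prime size, one mover trivial at `m₀` makes the tuples trivial at `m₀` transitive -/

section Model

variable {r : ℕ} {n : Fin r → ℕ} {R : Finset (PermsG n)}

/-- **BLOCKS OF PRIME SIZE.**  `R ⊆ ∏_m Sym(n_m)` closed under products and inverses, non-empty, transitive on the slot `m` of PRIME size `n_m`; if ONE
position of the slot `m` is moved by ONE tuple of `R` trivial at `m₀`, then the tuples of `R` trivial at `m₀` are TRANSITIVE on the slot `m`.  (They form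
a normal subgroup of `R`; the orbits of a normal subgroup of a transitive group are blocks, of one size dividing the prime `n_m`; a mover excludes size
`1`.) [cite: DixonMortimer1996, §1.6, Thm. 1.6A] -/
theorem stabTransitive_of_mover_prime (hmul : ∀ π ∈ R, ∀ π' ∈ R, π * π' ∈ R) (hinv : ∀ π ∈ R, π⁻¹ ∈ R) (hne : R.Nonempty) {m₀ m : Fin r}
    (hp : (n m).Prime) (htr : ∀ a a' : Fin (n m), ∃ π ∈ R, π m a = a') (hmov : ∃ a : Fin (n m), ∃ ν ∈ R, ν m₀ = 1 ∧ ν m a ≠ a)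
    (a a' : Fin (n m)) : ∃ ν ∈ R, ν m₀ = 1 ∧ ν m a = a' := by
  classical
  -- `R` as a group `G` acting on the slot `m`; the tuples trivial at `m₀` are the kernel `N` of the projection to the slot `m₀`
  let G : Subgroup (PermsG n) :=
    { carrier := ↑R
      mul_mem' := fun {π π'} hπ hπ' => hmul π hπ π' hπ'
      one_mem' := one_mem_of_closed hmul hinv hne
      inv_mem' := fun {π} hπ => hinv π hπ }
  let φ : ↥G →* Equiv.Perm (Fin (n m)) := (Pi.evalMonoidHom (fun l : Fin r => Equiv.Perm (Fin (n l))) m).comp G.subtype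
  let φ₀ : ↥G →* Equiv.Perm (Fin (n m₀)) := (Pi.evalMonoidHom (fun l : Fin r => Equiv.Perm (Fin (n l))) m₀).comp G.subtype
  let N : Subgroup ↥G := φ₀.ker
  letI : MulAction ↥G (Fin (n m)) := MulAction.compHom (Fin (n m)) φ
  have hsmulN : ∀ (g : ↥N) (x : Fin (n m)), g • x = ((g : ↥G) : PermsG n) m x := fun g x => rfl
  haveI : MulAction.IsPretransitive ↥G (Fin (n m)) := ⟨fun x y => by
    obtain ⟨π, hπ, h⟩ := htr x y
    exact ⟨⟨π, hπ⟩, h⟩⟩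
  obtain ⟨a₀, ν₀, hν₀, hν₀1, hν₀a⟩ := hmov
  -- the orbit of `a₀` under `N` is a block of the transitive group `G`: its size divides the prime `n m`
  have hB : MulAction.IsBlock ↥G (MulAction.orbit ↥N a₀) := MulAction.IsBlock.orbit_of_normal a₀
  have hdvd : (MulAction.orbit ↥N a₀).ncard ∣ n m := by
    have h := hB.ncard_dvd_card (MulAction.nonempty_orbit a₀)
    rwa [Nat.card_eq_fintype_card, Fintype.card_fin] at h
  -- it has at least two points: `a₀` and `ν₀ a₀`
  let g₀ : ↥N := ⟨⟨ν₀, hν₀⟩, by rw [MonoidHom.mem_ker]; exact hν₀1⟩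
  have hne1 : ¬ (MulAction.orbit ↥N a₀).ncard = 1 := by
    intro h1
    obtain ⟨b, hb⟩ := Set.ncard_eq_one.1 h1
    have h0 : a₀ ∈ MulAction.orbit ↥N a₀ := MulAction.mem_orbit_self a₀
    have h0' : g₀ • a₀ ∈ MulAction.orbit ↥N a₀ := MulAction.mem_orbit a₀ g₀
    rw [hb, Set.mem_singleton_iff] at h0 h0'
    exact hν₀a ((hsmulN g₀ a₀).symm.trans (h0'.trans h0.symm))
  -- hence it is the whole slot
  have hfull : (MulAction.orbit ↥N a₀).ncard = n m := ((Nat.dvd_prime hp).1 hdvd).resolve_left hne1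
  have huniv : MulAction.orbit ↥N a₀ = Set.univ :=
    Set.eq_of_subset_of_ncard_le (Set.subset_univ _) (by rw [Set.ncard_univ, Nat.card_eq_fintype_card, Fintype.card_fin, hfull])
  have ha : a ∈ MulAction.orbit ↥N a₀ := by rw [huniv]; exact Set.mem_univ a
  have ha' : a' ∈ MulAction.orbit ↥N a₀ := by rw [huniv]; exact Set.mem_univ a'
  obtain ⟨g₁, hg₁⟩ := MulAction.mem_orbit_iff.1 ha
  obtain ⟨g₂, hg₂⟩ := MulAction.mem_orbit_iff.1 ha'
  refine ⟨(((g₂ * g₁⁻¹ : ↥N) : ↥G) : PermsG n), ((g₂ * g₁⁻¹ : ↥N) : ↥G).2, ?_, ?_⟩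
  · have h := (g₂ * g₁⁻¹).2
    rw [MonoidHom.mem_ker] at h
    exact h
  · have h : (g₂ * g₁⁻¹) • a = a' := by rw [mul_smul, ← hg₁, inv_smul_smul, hg₂]
    rw [hsmulN] at h
    exact h

end Model

/-! ## §1b Realised tuples: prime relative degree, ONE value outside the Galois closure -/

section Realised

variable {I : Type} {r : ℕ} {Kf : I → Type} [∀ i, Field (Kf i)] [∀ i, NumberField (Kf i)] {i₀ : I} {is : Fin r → I} {n : Fin r → ℕ}
  {e : ∀ m : Fin r, (Kf (is m) →+* ℂ) ≃ Fin (n m) × Bool} {τ : Kf i₀ →+* ℂ} {im : ∀ m : Fin r, Kf i₀ →+* Kf (is m)}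
  (he_sign : ∀ (m : Fin r) (s : Kf (is m) →+* ℂ), (e m s).2 = true ↔ s.comp (im m) = τ)

include he_sign in
/-- Every slot is non-empty: a number field has a complex embedding, and the frame `e m` places it. [folklore] -/
theorem slot_pos_of_frame (m : Fin r) : 0 < n m := by
  have _ := he_sign
  obtain ⟨u⟩ : Nonempty (Kf (is m) →+* ℂ) := inferInstance
  exact Fin.pos (e m u).1

include he_sign in
/-- **STABILISER-TRANSITIVITY FOR A SLOT OF PRIME RELATIVE DEGREE FROM ONE VALUE OUTSIDE A GALOIS CLOSURE.**  `n_m = [K_m : k]` prime; if ONE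
`τ`-embedding `s` of `K_m` takes ONE value outside the Galois closure `L(K_{m₀})` of `K_{m₀}` in `ℂ`, then the realised tuples trivial at `m₀` are
transitive on the slot `m` (the realised tuples are transitive on the slot, `transitive_realisedTuples`; `s` is moved by a realised tuple trivial at `m₀`,
V2's `exists_realisedTuple_trivial_apply_ne`; blocks of prime size, `stabTransitive_of_mover_prime`). [cite: DixonMortimer1996, §1.6, Thm. 1.6A]
[cite: Lang2002, VI §1 Thm. 1.1 and Cor. 1.6] [cite: Shimura1998, §18.2 Lemma (i)] -/
theorem stabTransitive_realisedTuples_of_outside_prime (m₀ m : Fin r) (hp : (n m).Prime)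
    (hout : ∃ s : Kf (is m) →+* ℂ, s.comp (im m) = τ ∧ ∃ x, s x ∉ normalClosure ℚ (Kf (is m₀)) ℂ) (a a' : Fin (n m)) :
    ∃ ν ∈ realisedTuples e τ, ν m₀ = 1 ∧ ν m a = a' := by
  obtain ⟨s, hs, x, hx⟩ := hout
  have hs' : (e m).symm ((e m s).1, true) = s := by
    rw [show ((e m s).1, true) = e m s from Prod.ext rfl ((he_sign m s).2 hs).symm, Equiv.symm_apply_apply]
  exact stabTransitive_of_mover_prime (fun _ hπ _ hπ' => mul_mem_realisedTuples e τ hπ hπ') (fun _ hπ => inv_mem_realisedTuples hπ)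
    (realisedTuples_nonempty (e := e) he_sign) hp (fun b b' => transitive_realisedTuples (e := e) he_sign m b b')
    ⟨(e m s).1, exists_realisedTuple_trivial_apply_ne he_sign (slot_pos_of_frame he_sign) m₀ m (e m s).1 ⟨x, by rw [hs']; exact hx⟩⟩ a a'

end Realised

/-! ## §1c The automorphism form (no frames): the `hST` binder of V2 from one value outside a Galois closure -/

section Aut

variable {I : Type} {r : ℕ} {Kf : I → Type} [∀ i, Field (Kf i)] [∀ i, NumberField (Kf i)] [∀ i, IsCMField (Kf i)]
  {i₀ : I} {is : Fin r → I} {n : Fin r → ℕ} {τ : Kf i₀ →+* ℂ}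

/-- **THE `hST` BINDER FROM ONE VALUE OUTSIDE A GALOIS CLOSURE (prime relative degree).**  `k = Kf i₀` imaginary quadratic, `[K_l : ℚ] = 2 n_l` along
`i_l : k → K_l` for all slots `l`, `n_m` PRIME; if one `τ`-embedding of `K_m` takes one value outside `L(K_{m₀})`, then for all `τ`-embeddings `s, s'` of
`K_m` some automorphism of `ℂ` over `τ(k)` fixes every `τ`-embedding of `K_{m₀}` and carries `s` to `s'`. [cite: DixonMortimer1996, §1.6, Thm. 1.6A]
[cite: Shimura1998, §18.2 Lemma (i)] [cite: Lang2002, VI §1 Cor. 1.6] -/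
theorem exists_aut_fix_comp_eq_of_outside_prime (h2 : Module.finrank ℚ (Kf i₀) = 2) (hdeg : ∀ l : Fin r, Module.finrank ℚ (Kf (is l)) = 2 * n l)
    (im : ∀ l : Fin r, Kf i₀ →+* Kf (is l)) (m₀ m : Fin r) (hp : (n m).Prime)
    (hout : ∃ s : Kf (is m) →+* ℂ, s.comp (im m) = τ ∧ ∃ x, s x ∉ normalClosure ℚ (Kf (is m₀)) ℂ)
    (s s' : Kf (is m) →+* ℂ) (hs : s.comp (im m) = τ) (hs' : s'.comp (im m) = τ) :
    ∃ ρ : ℂ ≃+* ℂ, (ρ : ℂ →+* ℂ).comp τ = τ ∧ (∀ u : Kf (is m₀) →+* ℂ, u.comp (im m₀) = τ → (ρ : ℂ →+* ℂ).comp u = u) ∧ (ρ : ℂ →+* ℂ).comp s = s' := by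
  have hττ : ComplexEmbedding.conjugate τ ≠ τ := QuarticCM.conjugate_ne τ
  have hk : ∀ σ : Kf i₀ →+* ℂ, σ = τ ∨ σ = ComplexEmbedding.conjugate τ := fun σ => QuarticCM.eq_or_eq_conjugate_of_quadratic h2 τ σ
  have hfr : ∀ l : Fin r, ∃ e : (Kf (is l) →+* ℂ) ≃ Fin (n l) × Bool, (∀ t, (e t).2 = true ↔ t.comp (im l) = τ) ∧
      ∀ t, e (ComplexEmbedding.conjugate t) = ((e t).1, !(e t).2) := fun l => exists_signFrame (hdeg l) h2 (im l) hττ hk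
  choose e he_sign _ using hfr
  have hsymm : ∀ (l : Fin r) (t : Kf (is l) →+* ℂ), t.comp (im l) = τ → (e l).symm ((e l t).1, true) = t := fun l t ht => by
    rw [show ((e l t).1, true) = e l t from Prod.ext rfl ((he_sign l t).2 ht).symm, Equiv.symm_apply_apply]
  obtain ⟨ν, hν, hν₀, hνa⟩ := stabTransitive_realisedTuples_of_outside_prime (e := e) he_sign m₀ m hp hout (e m s).1 (e m s').1
  obtain ⟨ρ, hρτ, hρ⟩ := (mem_realisedTuples e τ ν).1 hν
  refine ⟨ρ, hρτ, fun u hu => ?_, ?_⟩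
  · have h := hρ m₀ (e m₀ u).1
    rwa [hν₀, hsymm m₀ u hu, Equiv.Perm.one_apply, hsymm m₀ u hu] at h
  · have h := hρ m (e m s).1
    rwa [hνa, hsymm m s hs, hsymm m s' hs'] at h

/-- **All pairs at once**: prime relative degrees everywhere and, for all `m₀ ≠ m`, one `τ`-embedding of `K_m` with one value outside `L(K_{m₀})` give the
stabiliser-transitivity hypothesis `hST` of `hodgeConjectureFor_biproduct_comp_of_stabiliserTransitive`. [cite: DixonMortimer1996, §1.6, Thm. 1.6A]
[cite: Shimura1998, §18.2 Lemma (i)] -/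
theorem stabiliserTransitive_of_outside_primes (h2 : Module.finrank ℚ (Kf i₀) = 2) (hdeg : ∀ l : Fin r, Module.finrank ℚ (Kf (is l)) = 2 * n l)
    (im : ∀ l : Fin r, Kf i₀ →+* Kf (is l)) (hpr : ∀ m, (n m).Prime)
    (hout : ∀ (m₀ m : Fin r), m₀ ≠ m → ∃ s : Kf (is m) →+* ℂ, s.comp (im m) = τ ∧ ∃ x, s x ∉ normalClosure ℚ (Kf (is m₀)) ℂ)
    (m₀ m : Fin r) (hm : m₀ ≠ m) (s s' : Kf (is m) →+* ℂ) (hs : s.comp (im m) = τ) (hs' : s'.comp (im m) = τ) :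
    ∃ ρ : ℂ ≃+* ℂ, (ρ : ℂ →+* ℂ).comp τ = τ ∧ (∀ u : Kf (is m₀) →+* ℂ, u.comp (im m₀) = τ → (ρ : ℂ →+* ℂ).comp u = u) ∧ (ρ : ℂ →+* ℂ).comp s = s' :=
  exists_aut_fix_comp_eq_of_outside_prime h2 hdeg im m₀ m (hpr m) (hout m₀ m hm) s s' hs hs'

end Aut

/-! ## §2 Headlines: prime relative degrees, one value outside each other's Galois closure -/

section Headline

variable {I : Type} {r : ℕ} {Kf : I → Type} [∀ i, Field (Kf i)] [∀ i, NumberField (Kf i)] [∀ i, IsCMField (Kf i)]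
  {i₀ : I} {is : Fin r → I} {n : Fin r → ℕ} {τ : Kf i₀ →+* ℂ}
  {A : Fin (r + 1) → AbelianVariety ℂ} {Φ : ∀ j : Fin (r + 1), CMType (Kf (mfSlots i₀ is j))}
  {ι : ∀ j, 𝓞 (Kf (mfSlots i₀ is j)) →+* End (A j)}
  {θ : ∀ j, Kf (mfSlots i₀ is j) →+* Module.End ℂ (complexBetti (A j).X 1)}

/-- **HEADLINE — PRIME RELATIVE DEGREES, ANY TYPES, ONE VALUE OUTSIDE EACH OTHER'S GALOIS CLOSURE; NO TOWER.**  `k = Kf i₀` imaginary quadratic,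
`E = A 0 ⊨ (k; {τ})` (`τ(δ) = i√d`), `B_m = A (m+1) ⊨ (K_m; Φ (m+1))` over CM fields `K_m ⊇ i_m(k)` with `[K_m : ℚ] = 2 n_m`, `n_m` PRIME, `k`-signatures
`p_m` (`0 < p_m`, `2 p_m ≤ n_m`); for all `m₀ ≠ m` SOME `τ`-embedding of `K_m` takes SOME value outside the Galois closure of `K_{m₀}` in `ℂ`.  Then the
Hodge conjecture holds for EVERY product of copies `⨁_j A(κ j)` GIVEN the single-slot Weil spaces `hW m`.  `HC_CM` is NOT asserted.
[cite: Pohlmann1968, Thm 1] [cite: MoonenZarhin1995Duke, Thm. 2.4] [cite: DixonMortimer1996, §1.6, Thm. 1.6A] [cite: Shimura1998, §18.2 Lemma (i)] -/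
theorem hodgeConjectureFor_biproduct_comp_of_primes_of_outside_closures (p : Fin r → ℕ) (hpr : ∀ m, (n m).Prime) (hp0 : ∀ m, 0 < p m)
    (hpn : ∀ m, 2 * p m ≤ n m) {N : ℕ} (κ : Fin N → Fin (r + 1)) (h2 : Module.finrank ℚ (Kf i₀) = 2)
    (hdeg : ∀ m : Fin r, Module.finrank ℚ (Kf (is m)) = 2 * n m) (im : ∀ m : Fin r, Kf i₀ →+* Kf (is m))
    (hout : ∀ (m₀ m : Fin r), m₀ ≠ m → ∃ s : Kf (is m) →+* ℂ, s.comp (im m) = τ ∧ ∃ x, s x ∉ normalClosure ℚ (Kf (is m₀)) ℂ)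
    {δ : 𝓞 (Kf i₀)} {d : ℕ} (hτ : τ (δ : Kf i₀) = Complex.I * (Real.sqrt d : ℂ))
    (hA : ∀ j, IsCMTypeRealisation (Φ j) (A j) (ι j) (θ j)) (hΨ : ∀ σ : Kf i₀ →+* ℂ, σ ∈ (Φ 0).1 ↔ σ = τ)
    (hp : ∀ m : Fin r, (Finset.univ.filter fun s : Kf (is m) →+* ℂ => s.comp (im m) = τ ∧ s ∈ (Φ m.succ).1).card = p m)
    (hW : ∀ m : Fin r, weilClassesOf (⨁ fun i => A (partSlots (n m - 2 * p m) m i))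
      (biproduct.map fun i => ι (partSlots (n m - 2 * p m) m i) (δfam im δ (partSlots (n m - 2 * p m) m i))) (n m - p m) d ≤
      algebraicClasses (⨁ fun i => A (partSlots (n m - 2 * p m) m i)).X (n m - p m)) :
    HodgeConjectureFor (⨁ fun j => A (κ j)).dim (⨁ fun j => A (κ j)).X :=
  hodgeConjectureFor_biproduct_comp_of_stabiliserTransitive p hpr hp0 hpn κ h2 hdeg im (stabiliserTransitive_of_outside_primes h2 hdeg im hpr hout)
    hτ hA hΨ hp hW

/-- **… and for every abelian variety DOMINATED by such a product.** `HC_CM` is NOT asserted. [cite: MumfordAV1970, §19] [cite: Pohlmann1968, Thm 1] -/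
theorem hodgeConjectureFor_of_avDominatedBy_comp_of_primes_of_outside_closures (p : Fin r → ℕ) (hpr : ∀ m, (n m).Prime) (hp0 : ∀ m, 0 < p m)
    (hpn : ∀ m, 2 * p m ≤ n m) {N : ℕ} (κ : Fin N → Fin (r + 1)) (h2 : Module.finrank ℚ (Kf i₀) = 2)
    (hdeg : ∀ m : Fin r, Module.finrank ℚ (Kf (is m)) = 2 * n m) (im : ∀ m : Fin r, Kf i₀ →+* Kf (is m))
    (hout : ∀ (m₀ m : Fin r), m₀ ≠ m → ∃ s : Kf (is m) →+* ℂ, s.comp (im m) = τ ∧ ∃ x, s x ∉ normalClosure ℚ (Kf (is m₀)) ℂ)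
    {δ : 𝓞 (Kf i₀)} {d : ℕ} (hτ : τ (δ : Kf i₀) = Complex.I * (Real.sqrt d : ℂ))
    (hA : ∀ j, IsCMTypeRealisation (Φ j) (A j) (ι j) (θ j)) (hΨ : ∀ σ : Kf i₀ →+* ℂ, σ ∈ (Φ 0).1 ↔ σ = τ)
    (hp : ∀ m : Fin r, (Finset.univ.filter fun s : Kf (is m) →+* ℂ => s.comp (im m) = τ ∧ s ∈ (Φ m.succ).1).card = p m)
    (hW : ∀ m : Fin r, weilClassesOf (⨁ fun i => A (partSlots (n m - 2 * p m) m i))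
      (biproduct.map fun i => ι (partSlots (n m - 2 * p m) m i) (δfam im δ (partSlots (n m - 2 * p m) m i))) (n m - p m) d ≤
      algebraicClasses (⨁ fun i => A (partSlots (n m - 2 * p m) m i)).X (n m - p m))
    {X : AbelianVariety ℂ} (hX : Domination.AVDominatedBy X (⨁ fun j => A (κ j))) : HodgeConjectureFor X.dim X.X :=
  Domination.hodgeConjectureFor_of_avDominatedBy
    (hodgeConjectureFor_biproduct_comp_of_primes_of_outside_closures p hpr hp0 hpn κ h2 hdeg im hout hτ hA hΨ hp hW) hX

/-- **HEADLINE — ANY NUMBER OF SEXTIC `(1,2)` AND DECIC `(2,3)` CM FIELDS SHARING `k`, EACH WITH A `τ`-EMBEDDING TAKING A VALUE OUTSIDE THE GALOIS CLOSURE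
OF EACH OTHER, GIVEN ONLY MARKMAN'S TWO THEOREMS — NO TOWER, NO ORDERING, NO `hST`.**  `k = Kf i₀` imaginary quadratic, `E = A 0 ⊨ (k; {τ})`,
`B_m = A (m+1) ⊨ (K_m; Φ (m+1))`, `[K_m : ℚ] = 2 n_m` with `(n_m, p_m) ∈ {(3,1), (5,2)}` (`p_m` members of `Φ (m+1)` over `τ`: simple CM threefolds ∕ Weil-type
fivefolds); for `m₀ ≠ m` some `τ`-embedding of `K_m` takes some value outside the Galois closure of `K_{m₀}`.  Then the Hodge conjecture holds for EVERY
product of copies `⨁_j A(κ j)`.  `HC_CM` is NOT asserted. [cite: Markman2025SurveySecant, Thm. 1.2] [cite: Markman2025SecantWeil, Thm 1.5.1]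
[cite: Pohlmann1968, Thm 1] [cite: MoonenZarhin1995Duke, Thm. 2.4] [cite: DixonMortimer1996, §1.6, Thm. 1.6A] -/
theorem hodgeConjectureFor_biproduct_comp_of_sexticsDecics_of_outside_closures (hW4 : Markman2025_weilClasses_algebraic_abelianFourfold)
    (hM6 : Markman2025_weilClasses_algebraic_hyperbolicSixfold) (n p : Fin r → ℕ) (hnp : ∀ m, (n m = 3 ∧ p m = 1) ∨ (n m = 5 ∧ p m = 2))
    {N : ℕ} (κ : Fin N → Fin (r + 1)) (h2 : Module.finrank ℚ (Kf i₀) = 2) (hdeg : ∀ m : Fin r, Module.finrank ℚ (Kf (is m)) = 2 * n m)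
    (im : ∀ m : Fin r, Kf i₀ →+* Kf (is m)) (hA : ∀ j, IsCMTypeRealisation (Φ j) (A j) (ι j) (θ j)) (hΨ : ∀ σ : Kf i₀ →+* ℂ, σ ∈ (Φ 0).1 ↔ σ = τ)
    (hp : ∀ m : Fin r, (Finset.univ.filter fun s : Kf (is m) →+* ℂ => s.comp (im m) = τ ∧ s ∈ (Φ m.succ).1).card = p m)
    (hout : ∀ (m₀ m : Fin r), m₀ ≠ m → ∃ s : Kf (is m) →+* ℂ, s.comp (im m) = τ ∧ ∃ x, s x ∉ normalClosure ℚ (Kf (is m₀)) ℂ) :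
    HodgeConjectureFor (⨁ fun j => A (κ j)).dim (⨁ fun j => A (κ j)).X :=
  hodgeConjectureFor_biproduct_comp_of_sexticsDecics_of_stabiliserTransitive hW4 hM6 n p hnp κ h2 hdeg im hA hΨ hp
    (stabiliserTransitive_of_outside_primes h2 hdeg im (fun m => by rcases hnp m with ⟨h, -⟩ | ⟨h, -⟩ <;> rw [h] <;> norm_num) hout)

/-- **Dominated form.** [cite: Markman2025SurveySecant, Thm. 1.2] [cite: Markman2025SecantWeil, Thm 1.5.1] [cite: MumfordAV1970, §19] -/
theorem hodgeConjectureFor_of_avDominatedBy_comp_of_sexticsDecics_of_outside_closures (hW4 : Markman2025_weilClasses_algebraic_abelianFourfold)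
    (hM6 : Markman2025_weilClasses_algebraic_hyperbolicSixfold) (n p : Fin r → ℕ) (hnp : ∀ m, (n m = 3 ∧ p m = 1) ∨ (n m = 5 ∧ p m = 2))
    {N : ℕ} (κ : Fin N → Fin (r + 1)) (h2 : Module.finrank ℚ (Kf i₀) = 2) (hdeg : ∀ m : Fin r, Module.finrank ℚ (Kf (is m)) = 2 * n m)
    (im : ∀ m : Fin r, Kf i₀ →+* Kf (is m)) (hA : ∀ j, IsCMTypeRealisation (Φ j) (A j) (ι j) (θ j)) (hΨ : ∀ σ : Kf i₀ →+* ℂ, σ ∈ (Φ 0).1 ↔ σ = τ)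
    (hp : ∀ m : Fin r, (Finset.univ.filter fun s : Kf (is m) →+* ℂ => s.comp (im m) = τ ∧ s ∈ (Φ m.succ).1).card = p m)
    (hout : ∀ (m₀ m : Fin r), m₀ ≠ m → ∃ s : Kf (is m) →+* ℂ, s.comp (im m) = τ ∧ ∃ x, s x ∉ normalClosure ℚ (Kf (is m₀)) ℂ)
    {X : AbelianVariety ℂ} (hX : Domination.AVDominatedBy X (⨁ fun j => A (κ j))) : HodgeConjectureFor X.dim X.X :=
  Domination.hodgeConjectureFor_of_avDominatedBy
    (hodgeConjectureFor_biproduct_comp_of_sexticsDecics_of_outside_closures hW4 hM6 n p hnp κ h2 hdeg im hA hΨ hp hout) hX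

end Headline

/-! ## §3 Non-isomorphic sextic CM fields through `k` lie outside each other's Galois closures -/

section Sextic

variable {I : Type} {r : ℕ} {Kf : I → Type} [∀ i, Field (Kf i)] [∀ i, NumberField (Kf i)] [∀ i, IsCMField (Kf i)]
  {i₀ : I} {is : Fin r → I} {τ : Kf i₀ →+* ℂ}

/-- **NON-ISOMORPHIC SEXTIC CM FIELDS THROUGH `k` LIE OUTSIDE EACH OTHER'S GALOIS CLOSURES.**  `k = Kf i₀` imaginary quadratic, `K_m = Kf (is m)`,
`K_{m₀} = Kf (is m₀)` SEXTIC CM fields containing `k` via `i_m`, `i_{m₀}`, with NO ring homomorphism `K_m → K_{m₀}`.  Then every `τ`-embedding `s` of `K_m`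
takes a value outside the Galois closure `L(K_{m₀})` of `K_{m₀}` in `ℂ`: otherwise `ℚ(τk)·u(K_{m₀})·s(K_m) ⊆ L(K_{m₀})` for a `τ`-embedding `u` of `K_{m₀}`,
a subfield of degree `18` (`finrank_adjoin_pair_of_isEmpty_ringHom`) of a field of degree `6` or `12` (`finrank_normalClosure_of_quadratic`).
[cite: Dodson1984, §5.1.2 Theorem] [cite: Lang2002, V §1 Prop. 1.2 and VI §1 Thm. 1.1] -/
theorem exists_apply_not_mem_normalClosure_of_isEmpty_ringHom (h2 : Module.finrank ℚ (Kf i₀) = 2) (im : ∀ m : Fin r, Kf i₀ →+* Kf (is m))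
    {m₀ m : Fin r} (h6₀ : Module.finrank ℚ (Kf (is m₀)) = 6) (h6 : Module.finrank ℚ (Kf (is m)) = 6) (hK : IsEmpty (Kf (is m) →+* Kf (is m₀)))
    (s : Kf (is m) →+* ℂ) (hs : s.comp (im m) = τ) : ∃ x, s x ∉ normalClosure ℚ (Kf (is m₀)) ℂ := by
  by_contra hall
  push Not at hall
  -- a `τ`-embedding `u` of `K_{m₀}`
  obtain ⟨u, hu⟩ : ∃ u : Kf (is m₀) →+* ℂ, u.comp (im m₀) = τ := by
    have hc := SexticOcticWeil.card_filter_comp_eq_of_finrank (n := 3) (im m₀) (by rw [h6₀]) h2 τ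
    obtain ⟨u, hu⟩ := Finset.card_pos.1 (by rw [hc]; exact Nat.succ_pos 2)
    exact ⟨u, (Finset.mem_filter.1 hu).2⟩
  -- the compositum `ℚ(τk)·u(K_{m₀})·s(K_m)` lies in `L(K_{m₀})`
  have hle : adjoin ℚ (Set.range τ) ⊔ adjoin ℚ (Set.range u ∪ Set.range s) ≤ normalClosure ℚ (Kf (is m₀)) ℂ := by
    refine sup_le (adjoin_le_iff.2 ?_) (adjoin_le_iff.2 ?_)
    · rintro _ ⟨y, rfl⟩
      rw [← hu]
      exact ringHom_apply_mem_normalClosure u _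
    · rintro _ (⟨y, rfl⟩ | ⟨y, rfl⟩)
      exacts [ringHom_apply_mem_normalClosure u y, hall y]
  -- degrees: `18 ≤ 6` or `18 ≤ 12`
  have h18 : Module.finrank ℚ ↥(adjoin ℚ (Set.range τ) ⊔ adjoin ℚ (Set.range u ∪ Set.range s)) = 9 * Module.finrank ℚ (Kf i₀) :=
    finrank_adjoin_pair_of_isEmpty_ringHom (im m₀) (im m) (by rw [h6₀, h2]) (by rw [h6, h2]) hK hu hs
  have hM := finrank_normalClosure_of_quadratic (K := Kf) h6₀ h2 (im m₀)
  have hle' := IntermediateField.finrank_le_of_le_right hle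
  rw [h18, h2] at hle'
  rcases hM with h | h <;> rw [h] at hle' <;> norm_num at hle'

/-- **Pairwise form**: pairwise `Hom(K_m, K_{m₀}) = ∅` (`m₀ ≠ m`) for sextic CM fields through `k` gives V2's hypothesis `hout` — every `τ`-embedding of
`K_m` takes a value outside `L(K_{m₀})`. [cite: Dodson1984, §5.1.2 Theorem] [cite: Lang2002, VI §1 Thm. 1.1] -/
theorem outside_closures_of_pairwise_isEmpty_ringHom (h2 : Module.finrank ℚ (Kf i₀) = 2) (h6 : ∀ m : Fin r, Module.finrank ℚ (Kf (is m)) = 6)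
    (im : ∀ m : Fin r, Kf i₀ →+* Kf (is m)) (hiso : ∀ (m₀ m : Fin r), m₀ ≠ m → IsEmpty (Kf (is m) →+* Kf (is m₀)))
    (m₀ m : Fin r) (hm : m₀ ≠ m) (s : Kf (is m) →+* ℂ) (hs : s.comp (im m) = τ) : ∃ x, s x ∉ normalClosure ℚ (Kf (is m₀)) ℂ :=
  exists_apply_not_mem_normalClosure_of_isEmpty_ringHom h2 im (h6 m₀) (h6 m) (hiso m₀ m hm) s hs

variable {A : Fin (r + 1) → AbelianVariety ℂ} {Φ : ∀ j : Fin (r + 1), CMType (Kf (mfSlots i₀ is j))}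
  {ι : ∀ j, 𝓞 (Kf (mfSlots i₀ is j)) →+* End (A j)}
  {θ : ∀ j, Kf (mfSlots i₀ is j) →+* Module.End ℂ (complexBetti (A j).X 1)}

/-- **HEADLINE — ANY NUMBER OF `(1,2)`-THREEFOLDS OVER PAIRWISE NON-ISOMORPHIC SEXTIC CM FIELDS SHARING `k`, GIVEN ONLY MARKMAN'S FOURFOLD THEOREM.**
`k = Kf i₀` imaginary quadratic, `E = A 0 ⊨ (k; {τ})`, `T_m = A (m+1) ⊨ (K_m; Φ (m+1))` over SEXTIC CM fields `K_m ⊇ i_m(k)` with ONE member of `Φ (m+1)` over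
`τ` (`(1,2)`-threefolds), and NO ring homomorphism `K_m → K_{m₀}` for `m₀ ≠ m` (pairwise non-isomorphic fields; Galois or not).  Then the Hodge conjecture
holds for EVERY product of copies `E^a × ∏_m T_m^{b_m}` (any number, any order).  `HC_CM` is NOT asserted.  NOT covered: non-isogenous threefolds over
ISOMORPHIC fields. [cite: Markman2025SurveySecant, Thm. 1.2] [cite: Pohlmann1968, Thm 1] [cite: MoonenZarhin1995Duke, Thm. 2.4] [cite: Dodson1984, §5.1.2 Theorem]
[cite: Lang2002, VI §1 Thm. 1.1 and Cor. 1.6] -/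
theorem hodgeConjectureFor_biproduct_comp_of_sextics_of_isEmpty_ringHom (hW4 : Markman2025_weilClasses_algebraic_abelianFourfold)
    {N : ℕ} (κ : Fin N → Fin (r + 1)) (h2 : Module.finrank ℚ (Kf i₀) = 2) (h6 : ∀ m : Fin r, Module.finrank ℚ (Kf (is m)) = 6)
    (im : ∀ m : Fin r, Kf i₀ →+* Kf (is m)) (hA : ∀ j, IsCMTypeRealisation (Φ j) (A j) (ι j) (θ j)) (hΨ : ∀ σ : Kf i₀ →+* ℂ, σ ∈ (Φ 0).1 ↔ σ = τ)
    (h1 : ∀ m : Fin r, (Finset.univ.filter fun s : Kf (is m) →+* ℂ => s.comp (im m) = τ ∧ s ∈ (Φ m.succ).1).card = 1)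
    (hiso : ∀ (m₀ m : Fin r), m₀ ≠ m → IsEmpty (Kf (is m) →+* Kf (is m₀))) :
    HodgeConjectureFor (⨁ fun j => A (κ j)).dim (⨁ fun j => A (κ j)).X :=
  hodgeConjectureFor_biproduct_comp_of_sextics_of_outside_closures hW4 κ h2 h6 im hA hΨ h1 (outside_closures_of_pairwise_isEmpty_ringHom h2 h6 im hiso)

/-- **Dominated form.** [cite: Markman2025SurveySecant, Thm. 1.2] [cite: MumfordAV1970, §19] -/
theorem hodgeConjectureFor_of_avDominatedBy_comp_of_sextics_of_isEmpty_ringHom (hW4 : Markman2025_weilClasses_algebraic_abelianFourfold)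
    {N : ℕ} (κ : Fin N → Fin (r + 1)) (h2 : Module.finrank ℚ (Kf i₀) = 2) (h6 : ∀ m : Fin r, Module.finrank ℚ (Kf (is m)) = 6)
    (im : ∀ m : Fin r, Kf i₀ →+* Kf (is m)) (hA : ∀ j, IsCMTypeRealisation (Φ j) (A j) (ι j) (θ j)) (hΨ : ∀ σ : Kf i₀ →+* ℂ, σ ∈ (Φ 0).1 ↔ σ = τ)
    (h1 : ∀ m : Fin r, (Finset.univ.filter fun s : Kf (is m) →+* ℂ => s.comp (im m) = τ ∧ s ∈ (Φ m.succ).1).card = 1)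
    (hiso : ∀ (m₀ m : Fin r), m₀ ≠ m → IsEmpty (Kf (is m) →+* Kf (is m₀)))
    {X : AbelianVariety ℂ} (hX : Domination.AVDominatedBy X (⨁ fun j => A (κ j))) : HodgeConjectureFor X.dim X.X :=
  Domination.hodgeConjectureFor_of_avDominatedBy (hodgeConjectureFor_biproduct_comp_of_sextics_of_isEmpty_ringHom hW4 κ h2 h6 im hA hΨ h1 hiso) hX

end Sextic

end Summit.HodgeConjecture.CorCM.MultiFieldWeil

end
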